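import Summits.CriticalPhenomena.CardyFormulaZ2.Theorems.CardyBoundaryCoulombGasRectilinearCardyOfEngineMemberPart1
import Summits.CriticalPhenomena.CardyFormulaZ2.Theorems.CardyBoundaryCoulombGasRectilinearCardyStubConjGeometry
import Summits.CriticalPhenomena.CardyFormulaZ2.Theorems.CardyBoundaryCoulombGasRectilinearCardyStubOrientation
import Summits.CriticalPhenomena.CardyFormulaZ2.Theorems.CardyBoundaryCoulombGasRectilinearCardyStubConjDensity
import Summits.CriticalPhenomena.CardyFormulaZ2.Theorems.CardyBoundaryCoulombGasRectilinearCardyOfClosureDensityLaw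
import Summits.CriticalPhenomena.CardyFormulaZ2.Theorems.CardyBoundaryCoulombGasRectilinearCardyLatticeBridge
import Summits.CriticalPhenomena.CardyFormulaZ2.Theorems.CardyBoundaryCoulombGasRectilinearCardyStubUniformiseG
import HarnessLib

/-!
# Line excursion-kernel-covariance of crux RectilinearCardy (stmt-CriticalPhenomena-5660), reshape c6-1: Cardy's formula on rectilinear polygons from ONE MEMBER of the engine

Lead `prover-line-stmt-CriticalPhenomena-5660-c6-0`. Main result `rectilinearCardy_of_engineMember1311`:
the crux `RectilinearCardy` (Cardy's formula for bond percolation on `ℤ²` at `p = 1/2` in every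
conformal rectangle with rectilinear boundary) follows from the SINGLE member
`(k = 4; L = (1,3,1,1); sink j = 1)` of the route's engine `BoundaryDefectGaussianR` (stmt-14132) —
the Baxter–Kelland–Wu insertion of three one-leg (boundary-condition-changing, weight `0`) defects at
the marks `d, b, a` and the three-leg sink (weight `1`) at the moving boundary point, whose pure-product
law `C |w′(x)| ∏_{p = a,b,d} |w(x) - w(p)|^{-2/3} ∏_{p < p'} |w(p) - w(p')|^{1/3}` is Cardy's crossing
formula in density form. This sharpens the landed `DensityIntegration_proof : BoundaryDefectGaussianR →
RectilinearCardy` (which quantifies over all leg data) to exactly what the line consumes;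
Part 1's `engineMember1311_of_engine` records that the member IS the route decl specialised (so the landed
`DensityIntegration_proof` factors through this file).

Composition (all landed): orientation split `pointwiseFromEngineMember` (= `stub_pointwiseFromEngineG`
with `pointwise_cw_of_member`, Part 1, in place of `pointwise_cw`) ∘ the lattice bridge `latticeBridge`
→ pointwise closure-density law → `stub_uniformiseG` → closure density law uniform on flat windows →
`rectilinearCardy_of_closureDensityAsymptoticsG` (density window law, partition, junction tightness,
boundary correspondence, Schwarz extension, continuum tail, flat-marks reduction, conjunct).
-- adapted from Theorems/CardyBoundaryCoulombGasRectilinearCardyStubPointwiseFromEngineG.lean (lead c3)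
Sources: Baxter–Kelland–Wu 1976 §3–4; Cardy 1992; Smirnov 2001 (shape of the argument); line card
`Cruxes/RectilinearCardy/Lines/excursion-kernel-covariance.md`; `Cruxes/RectilinearCardy/PICKED.md` (c6).
-/

noncomputable section

open Set Filter Topology MeasureTheory Metric
open Literature.Probability.RandomPlanarGeometry
open Literature.Probability.LatticeModels (Site meshPoint zdGraph)
open Summit.CriticalPhenomena.CardyFormulaZ2.Theorems.RectilinearCardy.Negative (IsRectilinear)
open Summit.CriticalPhenomena.CardyFormulaZ2.Theses.CardyBoundaryCoulombGas (BoundaryDefectGaussianR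
  RectilinearCardy)
open Literature.Probability.LatticeModels.CollarLegModel (LegInsertionData Zins ofDomain)

namespace Summit.CriticalPhenomena.CardyFormulaZ2.Cruxes.RectilinearCardy.ExcursionKernelCovariance

/-! ### Orientation split: member + bridge ⇒ pointwise closure-density law -/

/-- **Member + lattice bridge ⇒ pointwise closure-density law** (the registered `stub_pointwiseFromEngineG`
with its engine hypothesis weakened to the `(4; (1,3,1,1); 1)` member): decide the orientation at the
flat mark `a` (`stub_orientation`); clockwise: `pointwise_cw_of_member`; counter-clockwise: reflect by
complex conjugation (`stub_conjGeometry`, conjugate chart by `stub_chartAlgebra` (a)), apply the clockwise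
core to the conjugate copy and carry the conclusion back (`stub_conjDensity`; the profile is
conjugation-invariant). [cite: BaxterKellandWu1976, §3–§4] -/
theorem pointwiseFromEngineMember :
    (∃ C : ℝ, 0 < C ∧ ∀ (D : MarkedDomain 4),
        (∃ S : Finset (ℂ × ℂ), (∀ p ∈ S, p.1.re = p.2.re ∨ p.1.im = p.2.im) ∧
          frontier D.carrier ⊆ ⋃ p ∈ S, segment ℝ p.1 p.2) →
        (∀ i, ∃ r : ℝ, 0 < r ∧
          ((∀ z ∈ frontier D.carrier, dist z (D.pt i) < r → z.im = (D.pt i).im) ∨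
            (∀ z ∈ frontier D.carrier, dist z (D.pt i) < r → z.re = (D.pt i).re))) →
        ∀ (w : ℂ → ℂ) (U : Set ℂ), IsOpen U → D.carrier ⊆ U → (∀ i, D.pt i ∈ U) →
          DifferentiableOn ℂ w U → Set.BijOn w D.carrier {z : ℂ | 0 < z.im} →
          (∀ i, ∃ ε : ℝ, 0 < ε ∧
            StrictMonoOn (fun t : ℝ ↦ (w (D.boundary t)).re) (Set.Ioo (D.mark i - ε) (D.mark i + ε))) →
          ∀ (δ : ℕ → ℝ), (∀ n, 0 < δ n) → Tendsto δ atTop (nhds 0) →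
          ∀ (V : ℕ → Finset (ℤ × ℤ)),
            (∀ n, ∀ v : ℤ × ℤ, v ∈ V n ↔
              ((v.1 : ℂ) * δ n + (v.2 : ℂ) * δ n * Complex.I) ∈ closure D.carrier) →
          ∀ (p : ℕ → Fin 4 → ℤ × ℤ), (∀ n, Function.Injective (p n)) →
            (∀ i, Tendsto (fun n ↦ ((p n i).1 : ℂ) * δ n + ((p n i).2 : ℂ) * δ n * Complex.I)
              atTop (nhds (D.pt i))) →
            (∀ n, LegInsertionData.IsAdmissible
              ⟨(Finset.univ.erase 1).image (p n),
                fun v ↦ ∑ i ∈ (Finset.univ.erase 1).filter (fun i ↦ p n i = v),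
                  (![1, 3, 1, 1] : Fin 4 → ℕ) i, p n 1⟩ (V n)) →
            Tendsto (fun n ↦ (δ n) ^ (-(∑ i : Fin 4,
                (if i = (1 : Fin 4) then (1 - ((![1, 3, 1, 1] : Fin 4 → ℕ) 1 : ℝ))
                  else ((![1, 3, 1, 1] : Fin 4 → ℕ) i : ℝ)) *
                  ((if i = (1 : Fin 4) then (1 - ((![1, 3, 1, 1] : Fin 4 → ℕ) 1 : ℝ))
                    else ((![1, 3, 1, 1] : Fin 4 → ℕ) i : ℝ)) - 1) / 6)) *
                ‖Zins (V n) ⟨(Finset.univ.erase 1).image (p n),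
                    fun v ↦ ∑ i ∈ (Finset.univ.erase 1).filter (fun i ↦ p n i = v),
                      (![1, 3, 1, 1] : Fin 4 → ℕ) i, p n 1⟩‖ / ‖(ofDomain (V n)).Z‖) atTop
              (nhds (C * (∏ i : Fin 4, ∏ i' ∈ Finset.univ.filter (fun i' : Fin 4 ↦ i < i'),
                  ‖w (D.pt i) - w (D.pt i')‖ ^
                    ((if i = (1 : Fin 4) then (1 - ((![1, 3, 1, 1] : Fin 4 → ℕ) 1 : ℝ))
                        else ((![1, 3, 1, 1] : Fin 4 → ℕ) i : ℝ)) *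
                      (if i' = (1 : Fin 4) then (1 - ((![1, 3, 1, 1] : Fin 4 → ℕ) 1 : ℝ))
                        else ((![1, 3, 1, 1] : Fin 4 → ℕ) i' : ℝ)) / 3)) *
                ∏ i : Fin 4, ‖deriv w (D.pt i)‖ ^
                  ((if i = (1 : Fin 4) then (1 - ((![1, 3, 1, 1] : Fin 4 → ℕ) 1 : ℝ))
                      else ((![1, 3, 1, 1] : Fin 4 → ℕ) i : ℝ)) *
                    ((if i = (1 : Fin 4) then (1 - ((![1, 3, 1, 1] : Fin 4 → ℕ) 1 : ℝ))
                      else ((![1, 3, 1, 1] : Fin 4 → ℕ) i : ℝ)) - 1) / 6)))) →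
    (∀ R : ConformalRectangle, IsRectilinear R → FlatMarks R →
      (∃ u : ℂ, (u = 1 ∨ u = Complex.I ∨ u = -1 ∨ u = -Complex.I) ∧ ∃ r : ℝ, 0 < r ∧
        (∀ t t' : ℝ, R.mark 0 - r < t → t < t' → t' < R.mark 0 + r →
          0 < ((R.boundary t' - R.boundary t) / u).re ∧ ((R.boundary t' - R.boundary t) / u).im = 0) ∧
        (∀ z : ℂ, dist z (R.pt 0) < r →
          (z ∈ R.carrier ↔ 0 < -((z - R.pt 0) / u).im))) →
      ∀ σ σ' : ℝ, AdmissibleRange R σ σ' → ∀ τ ∈ Icc σ σ',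
        ∀ (δ : ℕ → ℝ), (∀ n, 0 < δ n) → Tendsto δ atTop (𝓝 0) →
        ∀ (v : ℕ → Site 2), (∀ n, v n ∈ boundaryRow R (δ n)) →
          Tendsto (fun n => meshPoint (δ n) (v n)) atTop (𝓝 (R.boundary τ)) →
          ∃ p : ℕ → Fin 4 → ℤ × ℤ,
            (∀ i : Fin 4, Tendsto (fun n => ((p n i).1 : ℂ) * δ n + ((p n i).2 : ℂ) * δ n * Complex.I)
              atTop (𝓝 ((![R.pt 3, R.boundary τ, R.pt 1, R.pt 0] : Fin 4 → ℂ) i))) ∧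
            (∀ᶠ n in atTop, Function.Injective (p n) ∧
              LegInsertionData.IsAdmissible
                (⟨(Finset.univ.erase 1).image (p n),
                  fun x ↦ ∑ i ∈ (Finset.univ.erase 1).filter (fun i ↦ p n i = x),
                    (![1, 3, 1, 1] : Fin 4 → ℕ) i, p n 1⟩ : LegInsertionData)
                ((closureFinset R (δ n)).image fun x : Site 2 => (x 0, x 1))) ∧
            ∀ ε : ℝ, 0 < ε → ∀ᶠ n in atTop,
              |‖Zins ((closureFinset R (δ n)).image fun x : Site 2 => (x 0, x 1))
                  (⟨(Finset.univ.erase 1).image (p n),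
                    fun x ↦ ∑ i ∈ (Finset.univ.erase 1).filter (fun i ↦ p n i = x),
                      (![1, 3, 1, 1] : Fin 4 → ℕ) i, p n 1⟩ : LegInsertionData)‖ /
                  ‖(ofDomain ((closureFinset R (δ n)).image fun x : Site 2 => (x 0, x 1))).Z‖ -
                closureDensity R (δ n) (v n)| ≤ ε * δ n) →
    ∀ R : ConformalRectangle, IsRectilinear R → FlatMarks R →
      ∀ (U : Set ℂ) (w : ℂ → ℂ), IsOpen U → R.carrier ⊆ U →
        R.pt 0 ∈ U → R.pt 1 ∈ U → R.pt 3 ∈ U →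
        DifferentiableOn ℂ w U → BijOn w R.carrier {z : ℂ | 0 < z.im} →
        ∀ (g : ℝ → ℝ) (S₀ S : ℝ), S₀ < 0 → R.mark 3 < S →
          (StrictMonoOn g (Icc S₀ S) ∨ StrictAntiOn g (Icc S₀ S)) →
          (∀ t ∈ Icc S₀ S, R.boundary t ∈ U → w (R.boundary t) = g t) →
        ∃ C : ℝ, 0 < C ∧
          ∀ σ σ' : ℝ, AdmissibleRange R σ σ' → R.boundary '' Icc σ σ' ⊆ U →
            (∀ τ ∈ Icc σ σ', w (R.boundary τ) ≠ w (R.pt 0) ∧ w (R.boundary τ) ≠ w (R.pt 1) ∧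
              w (R.boundary τ) ≠ w (R.pt 3)) →
            ∀ τ ∈ Icc σ σ', ∀ (δ : ℕ → ℝ), (∀ n, 0 < δ n) → Tendsto δ atTop (𝓝 0) →
              ∀ (v : ℕ → Site 2), (∀ n, v n ∈ boundaryRow R (δ n)) →
                Tendsto (fun n => meshPoint (δ n) (v n)) atTop (𝓝 (R.boundary τ)) →
                Tendsto (fun n => closureDensity R (δ n) (v n) / δ n) atTop
                  (𝓝 (C * (‖deriv w (R.boundary τ)‖ *
                    (‖w (R.boundary τ) - w (R.pt 0)‖ ^ 2 * ‖w (R.boundary τ) - w (R.pt 1)‖ ^ 2 *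
                        ‖w (R.boundary τ) - w (R.pt 3)‖ ^ 2) ^ (-(1 / 3 : ℝ))))) := by
  intro hE hL R hR hF U w hUo hΩU h0U h1U h3U hwd hwbij g S₀ S hS₀ h3S hgm hwg
  have hm0 : 0 ≤ R.mark 0 := (R.mark_mem 0).1
  have hm03 : R.mark 0 < R.mark 3 := R.strictMono_mark (show (0 : Fin 4) < 3 by decide)
  obtain ⟨b, hOb, hmatch⟩ := stub_orientation R hF
  have hm := hmatch U w g S₀ S hUo h0U hwd hwbij.mapsTo (by linarith) (by linarith) hwg hgm
  cases b with
  | true =>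
    -- clockwise: `g` decreases; apply the core directly
    obtain ⟨u, hu, r, hr, hdir, hside⟩ := hOb
    exact pointwise_cw_of_member hE hL R hR hF ⟨u, hu, r, hr, hdir, fun z hz => by simpa using hside z hz⟩ U w
      hUo hΩU h0U h1U h3U hwd hwbij g S₀ S hS₀ h3S (hm.2 rfl) hwg
  | false =>
    -- counter-clockwise: `g` increases; reflect by complex conjugation
    have hgm' : StrictMonoOn g (Icc S₀ S) := hm.1 rfl
    obtain ⟨hGex, hGtr⟩ := stub_conjGeometry
    obtain ⟨R', hR'⟩ := hGex R
    obtain ⟨hcar, hbdy, hmark⟩ := hR'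
    obtain ⟨hrect', hflat', hadm', horient', hrow'⟩ := hGtr R R' ⟨hcar, hbdy, hmark⟩
    obtain ⟨hXa, -, -⟩ := stub_chartAlgebra
    obtain ⟨hU'o, hw'd, hw'deriv, hw'bij⟩ := hXa U w hUo hwd
    -- the conjugate data
    set U' : Set ℂ := {z : ℂ | (starRingEnd ℂ) z ∈ U} with hU'
    set w' : ℂ → ℂ := fun z => -(starRingEnd ℂ) (w ((starRingEnd ℂ) z)) with hw'
    have hcarrier : R'.carrier = {z : ℂ | (starRingEnd ℂ) z ∈ R.carrier} := Set.ext hcar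
    have hpt' : ∀ i, R'.pt i = (starRingEnd ℂ) (R.pt i) := fun i => by
      show R'.boundary (R'.mark i) = _
      rw [hbdy, hmark]; rfl
    have hΩU' : R'.carrier ⊆ U' := fun z hz => hΩU ((hcar z).1 hz)
    have hptU' : ∀ i, R.pt i ∈ U → R'.pt i ∈ U' := fun i hi => by
      show (starRingEnd ℂ) (R'.pt i) ∈ U
      rw [hpt', Complex.conj_conj]; exact hi
    have hw'bijR : BijOn w' R'.carrier {z : ℂ | 0 < z.im} := by
      rw [hcarrier]; exact hw'bij R.carrier hwbij
    have hg' : StrictAntiOn (fun t => -g t) (Icc S₀ S) := fun a ha b hb hab =>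
      neg_lt_neg (hgm' ha hb hab)
    have hwg' : ∀ t ∈ Icc S₀ S, R'.boundary t ∈ U' → w' (R'.boundary t) = ((fun t => -g t) t : ℝ) := by
      intro t ht htU
      have htU0 : R.boundary t ∈ U := by
        have : (starRingEnd ℂ) (R'.boundary t) ∈ U := htU
        rwa [hbdy, Complex.conj_conj] at this
      show -(starRingEnd ℂ) (w ((starRingEnd ℂ) (R'.boundary t))) = ((-g t : ℝ) : ℂ)
      rw [hbdy, Complex.conj_conj, hwg t ht htU0, Complex.conj_ofReal, Complex.ofReal_neg]
    have horR' : ∃ u : ℂ, (u = 1 ∨ u = Complex.I ∨ u = -1 ∨ u = -Complex.I) ∧ ∃ r : ℝ, 0 < r ∧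
        (∀ t t' : ℝ, R'.mark 0 - r < t → t < t' → t' < R'.mark 0 + r →
          0 < ((R'.boundary t' - R'.boundary t) / u).re ∧ ((R'.boundary t' - R'.boundary t) / u).im = 0) ∧
        (∀ z : ℂ, dist z (R'.pt 0) < r → (z ∈ R'.carrier ↔ 0 < -((z - R'.pt 0) / u).im)) := by
      obtain ⟨u, hu, r, hr, hdir, hside⟩ := hOb
      exact horient' ⟨u, hu, r, hr, hdir, fun z hz => by simpa using hside z hz⟩
    have h3S' : R'.mark 3 < S := by rw [hmark]; exact h3S
    obtain ⟨C, hC, hmain⟩ := pointwise_cw_of_member hE hL R' (hrect' hR) (hflat' hF) horR' U' w' hU'o hΩU'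
      (hptU' 0 h0U) (hptU' 1 h1U) (hptU' 3 h3U) hw'd hw'bijR (fun t => -g t) S₀ S hS₀ h3S' hg' hwg'
    refine ⟨C, hC, fun σ σ' hadm hwinU hsep τ hτ δ hδ hδ0 v hv hvx => ?_⟩
    -- the conjugate window data
    have hwinU' : R'.boundary '' Icc σ σ' ⊆ U' := by
      rintro _ ⟨t, ht, rfl⟩
      show (starRingEnd ℂ) (R'.boundary t) ∈ U
      rw [hbdy, Complex.conj_conj]
      exact hwinU ⟨t, ht, rfl⟩
    have hval' : ∀ t, w' (R'.boundary t) = -(starRingEnd ℂ) (w (R.boundary t)) := fun t => by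
      show -(starRingEnd ℂ) (w ((starRingEnd ℂ) (R'.boundary t))) = _
      rw [hbdy, Complex.conj_conj]
    have hvalpt' : ∀ i, w' (R'.pt i) = -(starRingEnd ℂ) (w (R.pt i)) := fun i => by
      show w' (R'.boundary (R'.mark i)) = _
      rw [hval', hmark]; rfl
    have hsep' : ∀ t ∈ Icc σ σ', w' (R'.boundary t) ≠ w' (R'.pt 0) ∧ w' (R'.boundary t) ≠ w' (R'.pt 1) ∧
        w' (R'.boundary t) ≠ w' (R'.pt 3) := by
      intro t ht
      obtain ⟨h0, h1, h3⟩ := hsep t ht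
      rw [hval', hvalpt', hvalpt', hvalpt']
      refine ⟨fun h => h0 ?_, fun h => h1 ?_, fun h => h3 ?_⟩ <;>
        simpa using congrArg (starRingEnd ℂ) (neg_injective h)
    -- the reflected vertices
    have hv' : ∀ n, (![v n 0, -v n 1] : Site 2) ∈ boundaryRow R' (δ n) := fun n => hrow' _ _ (hv n)
    have hmesh : ∀ (δ : ℝ) (x : Site 2), meshPoint δ (![x 0, -x 1] : Site 2) = (starRingEnd ℂ) (meshPoint δ x) := by
      intro δ x
      apply Complex.ext <;> simp [Literature.Probability.LatticeModels.meshPoint_re,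
        Literature.Probability.LatticeModels.meshPoint_im]
    have hvx' : Tendsto (fun n => meshPoint (δ n) (![v n 0, -v n 1] : Site 2)) atTop (𝓝 (R'.boundary τ)) := by
      rw [hbdy]
      simp_rw [hmesh]
      exact (Complex.continuous_conj.tendsto _).comp hvx
    have key := hmain σ σ' (hadm' σ σ' hadm) hwinU' hsep' τ hτ δ hδ hδ0 (fun n => ![v n 0, -v n 1]) hv' hvx'
    -- carry the conclusion back: density and profile are reflection-invariant
    have hdens : ∀ n, closureDensity R' (δ n) (![v n 0, -v n 1] : Site 2) = closureDensity R (δ n) (v n) :=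
      fun n => stub_conjDensity R R' ⟨hcar, hbdy, hmark⟩ (δ n) (v n)
    simp_rw [hdens] at key
    have hderiv : ‖deriv w' (R'.boundary τ)‖ = ‖deriv w (R.boundary τ)‖ := by
      have hτU : R.boundary τ ∈ U := hwinU ⟨τ, hτ, rfl⟩
      rw [hbdy, hw'deriv _ (by rw [Complex.conj_conj]; exact hτU), Complex.conj_conj, norm_neg,
        Complex.norm_conj]
    have hnorm : ∀ i, ‖w' (R'.boundary τ) - w' (R'.pt i)‖ = ‖w (R.boundary τ) - w (R.pt i)‖ := fun i => by
      rw [hval', hvalpt']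
      have : -(starRingEnd ℂ) (w (R.boundary τ)) - -(starRingEnd ℂ) (w (R.pt i)) =
          (starRingEnd ℂ) (w (R.pt i) - w (R.boundary τ)) := by
        rw [map_sub]; ring
      rw [this, Complex.norm_conj, norm_sub_rev]
    simpa only [hderiv, hnorm] using key

/-! ### The crux from the member -/

/-- **Cardy's formula on rectilinear polygons from the `(4; (1,3,1,1); 1)` member of the engine.**
`RectilinearCardy` — for every conformal rectangle whose Jordan boundary lies in finitely many
axis-parallel segments, the bond-`ℤ²` crossing probability at `p = 1/2` converges to Cardy's function of
the modulus — follows from the single boundary Coulomb-gas law of the `(1,3,1,1; sink 1)` insertion on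
closure lattice polygons: member + lattice bridge ⇒ pointwise density law (`pointwiseFromEngineMember`,
`latticeBridge`) ⇒ uniform closure density law (`stub_uniformiseG`) ⇒ crux
(`rectilinearCardy_of_closureDensityAsymptoticsG`). [cite: BaxterKellandWu1976, §3–§4] -/
theorem rectilinearCardy_of_engineMember1311
    (hE : (∃ C : ℝ, 0 < C ∧ ∀ (D : MarkedDomain 4),
        (∃ S : Finset (ℂ × ℂ), (∀ p ∈ S, p.1.re = p.2.re ∨ p.1.im = p.2.im) ∧
          frontier D.carrier ⊆ ⋃ p ∈ S, segment ℝ p.1 p.2) →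
        (∀ i, ∃ r : ℝ, 0 < r ∧
          ((∀ z ∈ frontier D.carrier, dist z (D.pt i) < r → z.im = (D.pt i).im) ∨
            (∀ z ∈ frontier D.carrier, dist z (D.pt i) < r → z.re = (D.pt i).re))) →
        ∀ (w : ℂ → ℂ) (U : Set ℂ), IsOpen U → D.carrier ⊆ U → (∀ i, D.pt i ∈ U) →
          DifferentiableOn ℂ w U → Set.BijOn w D.carrier {z : ℂ | 0 < z.im} →
          (∀ i, ∃ ε : ℝ, 0 < ε ∧
            StrictMonoOn (fun t : ℝ ↦ (w (D.boundary t)).re) (Set.Ioo (D.mark i - ε) (D.mark i + ε))) →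
          ∀ (δ : ℕ → ℝ), (∀ n, 0 < δ n) → Tendsto δ atTop (nhds 0) →
          ∀ (V : ℕ → Finset (ℤ × ℤ)),
            (∀ n, ∀ v : ℤ × ℤ, v ∈ V n ↔
              ((v.1 : ℂ) * δ n + (v.2 : ℂ) * δ n * Complex.I) ∈ closure D.carrier) →
          ∀ (p : ℕ → Fin 4 → ℤ × ℤ), (∀ n, Function.Injective (p n)) →
            (∀ i, Tendsto (fun n ↦ ((p n i).1 : ℂ) * δ n + ((p n i).2 : ℂ) * δ n * Complex.I)
              atTop (nhds (D.pt i))) →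
            (∀ n, LegInsertionData.IsAdmissible
              ⟨(Finset.univ.erase 1).image (p n),
                fun v ↦ ∑ i ∈ (Finset.univ.erase 1).filter (fun i ↦ p n i = v),
                  (![1, 3, 1, 1] : Fin 4 → ℕ) i, p n 1⟩ (V n)) →
            Tendsto (fun n ↦ (δ n) ^ (-(∑ i : Fin 4,
                (if i = (1 : Fin 4) then (1 - ((![1, 3, 1, 1] : Fin 4 → ℕ) 1 : ℝ))
                  else ((![1, 3, 1, 1] : Fin 4 → ℕ) i : ℝ)) *
                  ((if i = (1 : Fin 4) then (1 - ((![1, 3, 1, 1] : Fin 4 → ℕ) 1 : ℝ))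
                    else ((![1, 3, 1, 1] : Fin 4 → ℕ) i : ℝ)) - 1) / 6)) *
                ‖Zins (V n) ⟨(Finset.univ.erase 1).image (p n),
                    fun v ↦ ∑ i ∈ (Finset.univ.erase 1).filter (fun i ↦ p n i = v),
                      (![1, 3, 1, 1] : Fin 4 → ℕ) i, p n 1⟩‖ / ‖(ofDomain (V n)).Z‖) atTop
              (nhds (C * (∏ i : Fin 4, ∏ i' ∈ Finset.univ.filter (fun i' : Fin 4 ↦ i < i'),
                  ‖w (D.pt i) - w (D.pt i')‖ ^
                    ((if i = (1 : Fin 4) then (1 - ((![1, 3, 1, 1] : Fin 4 → ℕ) 1 : ℝ))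
                        else ((![1, 3, 1, 1] : Fin 4 → ℕ) i : ℝ)) *
                      (if i' = (1 : Fin 4) then (1 - ((![1, 3, 1, 1] : Fin 4 → ℕ) 1 : ℝ))
                        else ((![1, 3, 1, 1] : Fin 4 → ℕ) i' : ℝ)) / 3)) *
                ∏ i : Fin 4, ‖deriv w (D.pt i)‖ ^
                  ((if i = (1 : Fin 4) then (1 - ((![1, 3, 1, 1] : Fin 4 → ℕ) 1 : ℝ))
                      else ((![1, 3, 1, 1] : Fin 4 → ℕ) i : ℝ)) *
                    ((if i = (1 : Fin 4) then (1 - ((![1, 3, 1, 1] : Fin 4 → ℕ) 1 : ℝ))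
                      else ((![1, 3, 1, 1] : Fin 4 → ℕ) i : ℝ)) - 1) / 6))))) :
    RectilinearCardy :=
  rectilinearCardy_of_closureDensityAsymptoticsG
    (stub_uniformiseG (pointwiseFromEngineMember hE latticeBridge))

end Summit.CriticalPhenomena.CardyFormulaZ2.Cruxes.RectilinearCardy.ExcursionKernelCovariance

end
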